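import Mathlib
import Literature.MathematicalPhysics.QuantumFieldTheory.Balaban1983to89.B11SupSize190
import Literature.MathematicalPhysics.QuantumFieldTheory.Balaban1983to89.B11SeminormSize190

/-!
# `Balaban1983to89.B11MeanValue190` — [Balaban1985Variational] Prop. 9 (190) p. 308 ⇒ bounds on `𝓗(B)` itself: the
# MEAN-VALUE DOMINATION hypothesis `hmv` of the (190)-knitting programme PROVED for the two concrete output sizes of
# record (`B11SupSize190.supSize`, `B11SeminormSize190.covDerivSize`/`covDerivBlockSize`) from pointwise
# differentiability of `τ ↦ 𝓗(τB)` along the segment and `𝓗(0) = 0`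

statement-level skeleton of published theorems with citation tags; proofs where landed; nothing here is a claim about
the Yang–Mills mass gap.

CITATION HEADER (lean-in-tree rule 2026-08-18).  T. Bałaban, *The variational problem and background fields in
renormalization group method for lattice gauge theories*, Commun. Math. Phys. **102**, 277–309 (1985),
doi:10.1007/BF01229381, bib `Balaban1985Variational` (cell paper B11 = [15] of [Balaban1989LargeFieldI]; Prop. 9 and
(190) p. 308, (174)–(177) pp. 305–306; (175) itself is the last display of p. 305 = PDF 29 l. 32 — citeloc docfix of this
version, r08 g13's sweep, re-read by this seat).  Consumers: T. Bałaban, CMP **122** (1989) 175–202, bib `Balaban1989LargeFieldI`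
(B15, §1 pp. 183–200) and CMP **119** (1988) 243–285, bib `Balaban1988Convergent` (B14, (3.7)/(3.8) p. 266, (3.18)/(3.19)
p. 268).
WHAT IS REPRODUCED: the hypothesis `hmv : ∀ s, (∀ t, bout.loc y (dH t B) ≤ s) → bout.loc y ℍB ≤ s` ("`ℍ(B)` is dominated by
the common bounds of the base-point derivatives `dH t B` along the segment") carried by EVERY (190)-knit of the cell —
r12 `B15HDecayLeaves.loc_le_of_meanValue`/`ineq145_of_ineq190`/`ineq138_first_of_ineq190`/`ineq157_first_of_ineq190`/
`boundH190_of_ineq190`/`ineq187_of_ineq190`/`boundH199B_of_ineq190`, `B15Ineq1xxFrom190.*`, `B15From190LayerSizes.*`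
(`hmv₀`, `hmv₁`), r11 `B14From190LayerSizes.*`/`B14From190SupSize.*` — recorded as LEFT in GAPS G-B15-r12-08 Addendum 2
(*"What is LEFT everywhere is unchanged: (190) between concrete sizes (= [15] Prop. 9), (2.61), `hmv`, geometry, located
conditions"*).  SKELETON rows: B11.Prop9/B11.Eq190 (owner r08), B15.Eq1.31/1.37–1.39/1.42/1.45–1.48/1.57–1.58/1.87/
1.90–1.98 (r12), B14.Eq3.7–3.8/3.18–3.19 (r11).  Unit `lit-balaban-p29` gen 8 (Phase-2 free target, G.5-34(d)), HOME
`run/shared/lean/pub/lit-balaban/`.  KNITTING — used BY NAME, nothing restated: r11 `B11SupSize190.supSize`/`supNorm`/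
`norm_apply_le_loc`/`loc_le_of_forall`, `B11SeminormSize190.covDerivSize`/`covDerivSeminorm`/`covDerivBlockSize`/`ofSeminorms`/
`norm_covDerivFwd_le_covDerivSize`, pv-lineage `B8Ineq132.covDerivFwd`, `B7Eq78Linearization.conjR`; Mathlib's mean value
inequality `norm_image_sub_le_of_norm_deriv_le_segment_01'`.

THE PRINTED TEXT.  [15] Prop. 9 p. 308 (as quoted in `B15HDecayLeaves`): *"|(δ/δB_ν(y′))𝓗_μ(B,x)|, |∇_x(δ/δB_ν(y′))𝓗_μ(B,x)|,
… ≤ O(1)[(L^jη)^{−1}, (L^jη)^{−2}, …]·(L^{j′}η)^{−d} exp(−⅛δ₀d(y,y′)) for x ∈ Δ(y), y ∈ Λ_j, y′ ∈ Λ_{j′}"* (190) — a bound on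
the DERIVATIVE of the Landau-gauge fluctuation map `B ↦ 𝓗(B)` of (174)–(175), valid on the whole ball of Prop. 9, with
`𝓗(0) = 0` ((175)/(177): 𝓗 = 𝒜₁ + H₁B − HD(𝒜₁ + H₁B), first order in B).  Every consumer sentence of [Balaban1989LargeFieldI]
§1 / [Balaban1988Convergent] §3 (*"The function ℍ … and its derivatives can be bounded on □̃ by B₃exp(−δ…)…ε"*) bounds the
VALUE `ℍ(B)`; the passage derivative-bound ⇒ value-bound is the mean value theorem along the segment `tB`, `t ∈ [0,1]`:
`ℍ(B)(x) = ∫₀¹ (δℍ/δB)(tB)·B (x) dt`, so every seminorm of point values of `ℍ(B)` is at most the supremum over `t` of the same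
seminorm of `(dℍ_{tB})B`.  The cell's knits carry exactly this as the hypothesis `hmv` (r12: *"the declared reading of how
Prop. 9's derivative bound controls 𝓗(B)"*).

WHAT THIS FILE PROVES (kernel-checked, zero `sorry`, theorems only — no definition, no named fact; axioms standard).  With the
family index `T := Set.Icc (0:ℝ) 1` and `dH t` the derivative of `ℍ` at `t•B` in the consumers' sense:
§1 `norm_le_of_hasDerivWithinAt_segment` (private): `γ(0) = 0`, `γ` differentiable on `[0,1]` within `[0,1]` with
   `‖γ′(t)‖ ≤ C` ⇒ `‖γ(1)‖ ≤ C` (Mathlib's `norm_image_sub_le_of_norm_deriv_le_segment_01'`).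
§2 VALUES — **`hmv_supSize`**: for r11's sup size `supSize g box blk` on `X → E` (`X` any point set, `E` a real normed space):
   if `ℍ(0)` vanishes on the box of `y` and, for every point `x` of the box, `τ ↦ ℍ(τ•B)(x)` has derivative `(dH τ B)(x)`
   within `[0,1]` at every `τ ∈ [0,1]`, then `∀ s, (∀ t, loc y (dH t B) ≤ s) → loc y (ℍ B) ≤ s` — EXACTLY the consumers' `hmv`
   (`hmv₀` of `B15From190LayerSizes`, `hmv` of `B14From190LayerSizes`), no other hypothesis.  `hmv_supSize_of_forall`: the
   same from differentiability at every point of `X` and `ℍ 0 = 0`.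
§3 FIRST-ORDER SIZE on the `ℤᵈ` carriers — **`covDerivSize_le_of_hasDerivWithinAt`**: the same domination for r11's
   `covDerivSize S ξ U₀` (max over the derivative points `(x, μ, ν) ∈ S` of `‖(∇^ξ_{U₀,μ} f_ν)(x)‖`, background `U₀` FIXED), from
   differentiability of the components `τ ↦ ℍ(τ•B)(x)_ν`, `τ ↦ ℍ(τ•B)(x + e_μ)_ν` (the covariant difference quotient is
   `ℝ`-linear in these two values: `hasDerivWithinAt_covDerivFwd`); **`hmv_covDerivBlockSize`** (r11's `covDerivBlockSize g y₀ S
   ξ U₀`) and **`hmv_ofSeminorms_smul_covDerivSize`** (the WEIGHTED size `ofSeminorms g y₀ (fun y => c • covDerivSize (S y) ξ U₀)`,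
   `c : ℝ≥0` — EXACTLY `hmv₁` of `B15From190LayerSizes.ineq148_of_ineq190_layer` with `c = (L^iη).toNNReal`); `_of_forall`
   variants from `E`-valued pointwise differentiability everywhere and `ℍ 0 = 0`.
HONEST SCOPE.  What REMAINS a hypothesis of the consumers after this file: the differentiability of the concrete `ℍ` of [15]
(174)–(175) along the segment with the derivative family the consumer feeds to (190) (print: analyticity of 𝓗, [15] Sect. G /
Prop. 9's ball), `ℍ(0) = 0` ((175)), and (190) itself for that family; this file only removes the calculus step.  The index
type of the consumers' derivative family is free (`{T : Type*}`); instantiating it with `Set.Icc 0 1` is the mean-value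
reading itself.  NOT summit progress.
-/

namespace Literature.MathematicalPhysics.QuantumFieldTheory.Balaban1983to89.B11MeanValue190

open Literature.MathematicalPhysics.QuantumFieldTheory.Balaban1983to89
open B11SectG B11SupSize190 B11SeminormSize190 Set
open scoped NNReal

/-! ## §1. The mean value inequality on `[0,1]` for a path starting at `0` -/

/-- `γ(0) = 0`, `γ` has derivative `γ′(t)` within `[0,1]` at every `t ∈ [0,1]`, `‖γ′(t)‖ ≤ C` on `[0,1]` ⇒ `‖γ(1)‖ ≤ C`.
[folklore] -/
private theorem norm_le_of_hasDerivWithinAt_segment {E : Type*} [NormedAddCommGroup E] [NormedSpace ℝ E]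
    {γ γ' : ℝ → E} {C : ℝ} (hγ : ∀ t ∈ Icc (0:ℝ) 1, HasDerivWithinAt γ (γ' t) (Icc (0:ℝ) 1) t) (h0 : γ 0 = 0)
    (hb : ∀ t ∈ Icc (0:ℝ) 1, ‖γ' t‖ ≤ C) : ‖γ 1‖ ≤ C := by
  have h := norm_image_sub_le_of_norm_deriv_le_segment_01' hγ (fun t ht => hb t (Ico_subset_Icc_self ht))
  rwa [h0, sub_zero] at h

/-- `0 ∈ [0,1]` as a point of the index type. [folklore] -/
private theorem zero_mem_Icc01 : (0:ℝ) ∈ Icc (0:ℝ) 1 := ⟨le_rfl, zero_le_one⟩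

/-! ## §2. Values: `hmv` for the sup size `supSize g box blk` -/

section Values

variable {g : B6.Geometry} {X : Type} {E : Type} [NormedAddCommGroup E] [NormedSpace ℝ E]
variable {box : g.Site → Finset X} {blk : X → g.Site}
variable {FB : Type*} [AddCommGroup FB] [Module ℝ FB]

/-- **`hmv` for the sup size (values).**  `ℍ : FB → (X → E)` any map with `ℍ(0)(x) = 0` on the box of `y`, `dH t` (`t ∈ [0,1]`)
linear maps such that `τ ↦ ℍ(τ•B)(x)` has derivative `(dH τ B)(x)` within `[0,1]` at every `τ ∈ [0,1]` and every `x ∈ box y`: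
then `ℍ(B)` is dominated at `y` by the common bounds of the `dH t B` — the hypothesis `hmv` of `B15HDecayLeaves.loc_le_of_meanValue`
and of every (190)-knit at `bout := supSize g box blk`, PROVED (mean value inequality at each point of the box).
[cite: Balaban1985Variational, Prop. 9 (190) p.308, (175) p.305] -/
theorem hmv_supSize (H : FB → X → E) (dH : Icc (0:ℝ) 1 → FB →ₗ[ℝ] (X → E)) (B : FB) (y : g.Site)
    (h0 : ∀ x ∈ box y, H 0 x = 0)
    (hderiv : ∀ x ∈ box y, ∀ (t : ℝ) (ht : t ∈ Icc (0:ℝ) 1),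
      HasDerivWithinAt (fun τ : ℝ => H (τ • B) x) (dH ⟨t, ht⟩ B x) (Icc (0:ℝ) 1) t) :
    ∀ s : ℝ, (∀ t, (supSize g box blk : BlockNorm g (X → E)).loc y (dH t B) ≤ s) →
      (supSize g box blk : BlockNorm g (X → E)).loc y (H B) ≤ s := by
  classical
  intro s hs
  have hs0 : 0 ≤ s := ((supSize g box blk : BlockNorm g (X → E)).loc_nonneg y _).trans (hs ⟨0, zero_mem_Icc01⟩)
  refine loc_le_of_forall hs0 fun x hx => ?_
  -- the path `τ ↦ ℍ(τ•B)(x)` and its derivative, extended by `0` off `[0,1]`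
  set γ' : ℝ → E := fun t => if ht : t ∈ Icc (0:ℝ) 1 then dH ⟨t, ht⟩ B x else 0 with hγ'
  have hγ : ∀ t ∈ Icc (0:ℝ) 1, HasDerivWithinAt (fun τ : ℝ => H (τ • B) x) (γ' t) (Icc (0:ℝ) 1) t := by
    intro t ht
    simp only [hγ', dif_pos ht]
    exact hderiv x hx t ht
  have hb : ∀ t ∈ Icc (0:ℝ) 1, ‖γ' t‖ ≤ s := by
    intro t ht
    simp only [hγ', dif_pos ht]
    exact (norm_apply_le_loc (g := g) (blk := blk) hx (dH ⟨t, ht⟩ B)).trans (hs ⟨t, ht⟩)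
  have h := norm_le_of_hasDerivWithinAt_segment hγ (by simp only [zero_smul]; exact h0 x hx) hb
  simpa only [one_smul] using h

/-- The same from differentiability at EVERY point of `X` and `ℍ(0) = 0`. [cite: Balaban1985Variational, Prop. 9 (190) p.308, (175) p.305] -/
theorem hmv_supSize_of_forall (H : FB → X → E) (dH : Icc (0:ℝ) 1 → FB →ₗ[ℝ] (X → E)) (B : FB) (y : g.Site)
    (h0 : H 0 = 0)
    (hderiv : ∀ x, ∀ (t : ℝ) (ht : t ∈ Icc (0:ℝ) 1),
      HasDerivWithinAt (fun τ : ℝ => H (τ • B) x) (dH ⟨t, ht⟩ B x) (Icc (0:ℝ) 1) t) :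
    ∀ s : ℝ, (∀ t, (supSize g box blk : BlockNorm g (X → E)).loc y (dH t B) ≤ s) →
      (supSize g box blk : BlockNorm g (X → E)).loc y (H B) ≤ s :=
  hmv_supSize H dH B y (fun x _ => by rw [h0]; rfl) (fun x _ => hderiv x)

end Values

/-! ## §3. First-order size on the `ℤᵈ` carriers: `hmv` for `covDerivSize` / `covDerivBlockSize` / the weighted size -/

section CovDeriv

variable {d : ℕ} {𝔸 : Type} [NormedRing 𝔸] [NormedAlgebra ℂ 𝔸]
variable {FB : Type*} [AddCommGroup FB] [Module ℝ FB]

/-- The covariant difference quotient `(∇^ξ_{U₀,μ} f_ν)(x) = ξ⁻¹(R(U₀(x,μ))f_ν(x+e_μ) − f_ν(x))` at a FIXED background is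
`ℝ`-linear in the two values `f_ν(x + e_μ)`, `f_ν(x)`: derivatives along a path of fields pass through it.
[cite: Balaban1985RegularSpaces, (1.1) p.76] -/
theorem hasDerivWithinAt_covDerivFwd {F : ℝ → B7Prop1Explicit.Site d → Fin d → 𝔸}
    {F' : B7Prop1Explicit.Site d → Fin d → 𝔸} {s : Set ℝ} {t : ℝ} (ξ : ℝ)
    (U₀ : B7Prop1Explicit.Site d → Fin d → 𝔸ˣ) (x : B7Prop1Explicit.Site d) (μ ν : Fin d)
    (h₁ : HasDerivWithinAt (fun τ => F τ (x + B7Prop1Explicit.e μ) ν) (F' (x + B7Prop1Explicit.e μ) ν) s t)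
    (h₂ : HasDerivWithinAt (fun τ => F τ x ν) (F' x ν) s t) :
    HasDerivWithinAt (fun τ => B8Ineq132.covDerivFwd ξ U₀ μ (fun z => F τ z ν) x)
      (B8Ineq132.covDerivFwd ξ U₀ μ (fun z => F' z ν) x) s t := by
  unfold B8Ineq132.covDerivFwd
  simp only [B7Eq78Linearization.conjR_apply]
  exact (((h₁.const_mul _).mul_const _).sub h₂).const_smul ξ⁻¹

/-- **Mean-value domination for the first-order size `covDerivSize S ξ U₀`.**  `ℍ(0) = 0` at the points used by `S`, and for
every derivative point `(x, μ, ν) ∈ S` the components `τ ↦ ℍ(τ•B)(x + e_μ)_ν`, `τ ↦ ℍ(τ•B)(x)_ν` have derivatives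
`(dH τ B)(x + e_μ)_ν`, `(dH τ B)(x)_ν` within `[0,1]` on `[0,1]`: then `covDerivSize S ξ U₀ (ℍ B) ≤ s` whenever all
`covDerivSize S ξ U₀ (dH t B) ≤ s`. [cite: Balaban1985Variational, Prop. 9 (190) p.308, (175) p.305] -/
theorem covDerivSize_le_of_hasDerivWithinAt (H : FB → B7Prop1Explicit.Site d → Fin d → 𝔸)
    (dH : Icc (0:ℝ) 1 → FB →ₗ[ℝ] (B7Prop1Explicit.Site d → Fin d → 𝔸)) (B : FB)
    (S : Finset (B7Prop1Explicit.Site d × Fin d × Fin d)) {ξ : ℝ} {U₀ : B7Prop1Explicit.Site d → Fin d → 𝔸ˣ}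
    (h0 : ∀ p ∈ S, H 0 (p.1 + B7Prop1Explicit.e p.2.1) p.2.2 = 0 ∧ H 0 p.1 p.2.2 = 0)
    (hderiv : ∀ p ∈ S, ∀ (t : ℝ) (ht : t ∈ Icc (0:ℝ) 1),
      HasDerivWithinAt (fun τ : ℝ => H (τ • B) (p.1 + B7Prop1Explicit.e p.2.1) p.2.2)
          (dH ⟨t, ht⟩ B (p.1 + B7Prop1Explicit.e p.2.1) p.2.2) (Icc (0:ℝ) 1) t ∧
        HasDerivWithinAt (fun τ : ℝ => H (τ • B) p.1 p.2.2) (dH ⟨t, ht⟩ B p.1 p.2.2) (Icc (0:ℝ) 1) t)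
    {s : ℝ} (hs : ∀ t, covDerivSize S ξ U₀ (dH t B) ≤ s) : covDerivSize S ξ U₀ (H B) ≤ s := by
  classical
  have hs0 : 0 ≤ s := (apply_nonneg _ _).trans (hs ⟨0, zero_mem_Icc01⟩)
  unfold covDerivSize
  refine Seminorm.finset_sup_apply_le hs0 fun p hp => ?_
  rw [covDerivSeminorm_apply]
  obtain ⟨x, μ, ν⟩ := p
  -- the path `τ ↦ (∇^ξ_{U₀,μ} ℍ(τ•B)_ν)(x)` and its derivative, extended by `0` off `[0,1]`
  set γ' : ℝ → 𝔸 := fun t => if ht : t ∈ Icc (0:ℝ) 1 then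
    B8Ineq132.covDerivFwd ξ U₀ μ (fun z => dH ⟨t, ht⟩ B z ν) x else 0 with hγ'
  have hd₁ : ∀ (t : ℝ) (ht : t ∈ Icc (0:ℝ) 1), HasDerivWithinAt (fun τ : ℝ => H (τ • B) (x + B7Prop1Explicit.e μ) ν)
      (dH ⟨t, ht⟩ B (x + B7Prop1Explicit.e μ) ν) (Icc (0:ℝ) 1) t := fun t ht => (hderiv _ hp t ht).1
  have hd₂ : ∀ (t : ℝ) (ht : t ∈ Icc (0:ℝ) 1), HasDerivWithinAt (fun τ : ℝ => H (τ • B) x ν)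
      (dH ⟨t, ht⟩ B x ν) (Icc (0:ℝ) 1) t := fun t ht => (hderiv _ hp t ht).2
  have h01 : H 0 (x + B7Prop1Explicit.e μ) ν = 0 := (h0 _ hp).1
  have h02 : H 0 x ν = 0 := (h0 _ hp).2
  have hγ : ∀ t ∈ Icc (0:ℝ) 1, HasDerivWithinAt
      (fun τ : ℝ => B8Ineq132.covDerivFwd ξ U₀ μ (fun z => H (τ • B) z ν) x) (γ' t) (Icc (0:ℝ) 1) t := by
    intro t ht
    simp only [hγ', dif_pos ht]
    exact hasDerivWithinAt_covDerivFwd (F := fun τ => H (τ • B)) ξ U₀ x μ ν (hd₁ t ht) (hd₂ t ht)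
  have hb : ∀ t ∈ Icc (0:ℝ) 1, ‖γ' t‖ ≤ s := by
    intro t ht
    simp only [hγ', dif_pos ht]
    exact (norm_covDerivFwd_le_covDerivSize hp (dH ⟨t, ht⟩ B)).trans (hs ⟨t, ht⟩)
  have hzero : B8Ineq132.covDerivFwd ξ U₀ μ (fun z => H ((0:ℝ) • B) z ν) x = 0 := by
    rw [zero_smul]
    simp [B8Ineq132.covDerivFwd, B7Eq78Linearization.conjR_apply, h01, h02]
  have h := norm_le_of_hasDerivWithinAt_segment hγ hzero hb
  simpa only [one_smul] using h

/-- The same from `E`-valued differentiability at EVERY lattice point and `ℍ(0) = 0`. [cite: Balaban1985Variational, Prop. 9 (190) p.308, (175) p.305] -/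
theorem covDerivSize_le_of_forall (H : FB → B7Prop1Explicit.Site d → Fin d → 𝔸)
    (dH : Icc (0:ℝ) 1 → FB →ₗ[ℝ] (B7Prop1Explicit.Site d → Fin d → 𝔸)) (B : FB)
    (S : Finset (B7Prop1Explicit.Site d × Fin d × Fin d)) {ξ : ℝ} {U₀ : B7Prop1Explicit.Site d → Fin d → 𝔸ˣ}
    (h0 : H 0 = 0)
    (hderiv : ∀ z, ∀ (t : ℝ) (ht : t ∈ Icc (0:ℝ) 1),
      HasDerivWithinAt (fun τ : ℝ => H (τ • B) z) (dH ⟨t, ht⟩ B z) (Icc (0:ℝ) 1) t)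
    {s : ℝ} (hs : ∀ t, covDerivSize S ξ U₀ (dH t B) ≤ s) : covDerivSize S ξ U₀ (H B) ≤ s :=
  covDerivSize_le_of_hasDerivWithinAt H dH B S (fun p _ => by rw [h0]; exact ⟨rfl, rfl⟩)
    (fun p _ t ht => ⟨(hasDerivWithinAt_pi.mp (hderiv _ t ht)) _, (hasDerivWithinAt_pi.mp (hderiv _ t ht)) _⟩) hs

variable {g : B6.Geometry}

/-- **`hmv` for r11's block size `covDerivBlockSize g y₀ S ξ U₀`** (first-order output size of (190) on the `ℤᵈ` carriers):
PROVED from `ℍ(0) = 0` and pointwise differentiability along the segment. [cite: Balaban1985Variational, Prop. 9 (190) p.308, (175) p.305] -/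
theorem hmv_covDerivBlockSize (H : FB → B7Prop1Explicit.Site d → Fin d → 𝔸)
    (dH : Icc (0:ℝ) 1 → FB →ₗ[ℝ] (B7Prop1Explicit.Site d → Fin d → 𝔸)) (B : FB) {y₀ : g.Site} (y : g.Site)
    {S : g.Site → Finset (B7Prop1Explicit.Site d × Fin d × Fin d)} {ξ : ℝ} {U₀ : B7Prop1Explicit.Site d → Fin d → 𝔸ˣ}
    (h0 : H 0 = 0)
    (hderiv : ∀ z, ∀ (t : ℝ) (ht : t ∈ Icc (0:ℝ) 1),
      HasDerivWithinAt (fun τ : ℝ => H (τ • B) z) (dH ⟨t, ht⟩ B z) (Icc (0:ℝ) 1) t) :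
    ∀ s : ℝ, (∀ t, (covDerivBlockSize g y₀ S ξ U₀).loc y (dH t B) ≤ s) →
      (covDerivBlockSize g y₀ S ξ U₀).loc y (H B) ≤ s :=
  fun _ hs => covDerivSize_le_of_forall H dH B (S y) h0 hderiv hs

/-- **`hmv` for the WEIGHTED first-order size `ofSeminorms g y₀ (fun y => c • covDerivSize (S y) ξ U₀)`** (`c : ℝ≥0`; the
consumers' `(L^iη).toNNReal • covDerivSize (S y) η U₀`, hypothesis `hmv₁` of `B15From190LayerSizes.ineq148_of_ineq190_layer`):
PROVED from `ℍ(0) = 0` and pointwise differentiability along the segment. [cite: Balaban1985Variational, Prop. 9 (190) p.308, (175) p.305] -/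
theorem hmv_ofSeminorms_smul_covDerivSize (H : FB → B7Prop1Explicit.Site d → Fin d → 𝔸)
    (dH : Icc (0:ℝ) 1 → FB →ₗ[ℝ] (B7Prop1Explicit.Site d → Fin d → 𝔸)) (B : FB) {y₀ : g.Site} (y : g.Site)
    {S : g.Site → Finset (B7Prop1Explicit.Site d × Fin d × Fin d)} {ξ : ℝ} {U₀ : B7Prop1Explicit.Site d → Fin d → 𝔸ˣ}
    (c : ℝ≥0) (h0 : H 0 = 0)
    (hderiv : ∀ z, ∀ (t : ℝ) (ht : t ∈ Icc (0:ℝ) 1),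
      HasDerivWithinAt (fun τ : ℝ => H (τ • B) z) (dH ⟨t, ht⟩ B z) (Icc (0:ℝ) 1) t) :
    ∀ s : ℝ, (∀ t, (ofSeminorms g y₀ (fun y => c • covDerivSize (S y) ξ U₀)).loc y (dH t B) ≤ s) →
      (ofSeminorms g y₀ (fun y => c • covDerivSize (S y) ξ U₀)).loc y (H B) ≤ s := by
  intro s hs
  simp only [ofSeminorms_loc, smul_apply, NNReal.smul_def, smul_eq_mul] at hs ⊢
  have hs0 : 0 ≤ s := le_trans (mul_nonneg c.coe_nonneg (apply_nonneg _ _)) (hs ⟨0, zero_mem_Icc01⟩)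
  rcases eq_or_lt_of_le c.coe_nonneg with hc | hc
  · rw [← hc, zero_mul]
    exact hs0
  · have h := covDerivSize_le_of_forall H dH B (S y) h0 hderiv (s := s / c)
      (fun t => by rw [le_div_iff₀ hc, mul_comm]; exact hs t)
    rwa [le_div_iff₀ hc, mul_comm] at h

end CovDeriv

end Literature.MathematicalPhysics.QuantumFieldTheory.Balaban1983to89.B11MeanValue190
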